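import Literature.Probability.LatticeModels.PointwiseScalingLimitEtaExists
import Literature.Probability.LatticeModels.CriticalAxisRatioRegularity
import HarnessLib

/-!
# Crux `IsingEuclidUpgradeR2RotInvPowerLaw` (stmt-CriticalPhenomena-0634), line `tower_profile_rigidity`:
# stub U `stub_uniformDilationTransfer` — the integer dilation law forces the UNIFORM dilation law

Write `G := criticalTwoPoint 3` for the critical two-point function `⟨σ₀σ_x⟩_{β_c}` of the nearest-neighbour
Ising model on `ℤ³` and `g(n) := G(n e₀)` for its restriction to a lattice axis.

**Theorem** (`stub_uniformDilationTransfer`, the registered stub U of the line, verbatim). For every `Δ`: if the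
integer dilation law `g(kn)·k^{2Δ}/g(n) → 1` (`n → ∞`) holds for every `k ≥ 1`, then for all sequences `b → ∞`
and `m` with `b ≤ m ≤ 2b` eventually, `g(m)·(m/b)^{2Δ}/g(b) → 1` — the law holds UNIFORMLY on windows `[b, 2b]`.

Proof (classical regular variation of monotone log-convex sequences). Tree inputs: `g > 0`
(`criticalTwoPoint_axis_pos`, Simon–Lieb), `g` nonincreasing (`criticalTwoPoint_axis_antitone`, Messager–Miracle-Solé),
`g` log-convex from index `1` on (`criticalTwoPoint_axis_ratio_mono`, Aizenman–Duminil-Copin 2021 Prop. 5.3). The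
real-variable core (namespace `RV`, abstract `g` with these three properties): with `d_j := log g(j) − log g(j+1)`
(nonnegative, nonincreasing from `j = 1`) and the window sums `∑_{kn ≤ i < (k+1)n} d_i = log g(kn) − log g((k+1)n)
→ 2Δ log((k+1)/k)` (dilation laws at `k`, `k+1`), the sandwich `n·d_{(k+1)n} ≤ window ≤ n·d_{kn}` gives
`N d_N → 2Δ` (Claim A, `RV.tendsto_mul_dec`); then `log g(b) − log g(m) − 2Δ log(m/b) =
∑_{b ≤ j < m} (d_j − 2Δ log((j+1)/j)) = ∑_{b ≤ j < m} o(1)/j = o(1)` uniformly on `b ≤ m ≤ 2b` (Claim B,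
`RV.uniform_of_integer`); exponentiate.

References: Bingham–Goldie–Teugels, Regular Variation (CUP 1987), §1.9 (regularly varying sequences) — folklore;
M. Aizenman, H. Duminil-Copin, Ann. of Math. 194 (2021), Prop. 5.3 [AizenmanDuminilCopinAnnals2021] for the
log-convexity input. No definition is introduced (decrements and window sums are written out in full).
-/

noncomputable section

namespace Summit.CriticalPhenomena.Ising3DConformalLimit.Cruxes.IsingEuclidUpgradeR2RotInvPowerLaw.TowerProfileRigidity

open Filter Topology Literature.Probability.LatticeModels

/-! ## Real-variable core: regular variation of a positive, antitone, log-convex sequence -/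

namespace RV
variable {g : ℕ → ℝ}

/-- Antitonicity of `g` ⇒ the log-decrements `d_j := log g(j) − log g(j+1)` are nonnegative. -/
theorem dec_nonneg (hpos : ∀ n, 0 < g n) (hanti : ∀ n, g (n + 1) ≤ g n) (j : ℕ) :
    0 ≤ (Real.log (g j) - Real.log (g (j + 1))) := by
  have := Real.log_le_log (hpos (j + 1)) (hanti j)
  linarith

/-- Log-convexity ⇒ the decrements are nonincreasing from index `1` on. -/
theorem dec_succ_le (hpos : ∀ n, 0 < g n)
    (hconv : ∀ k, g (k + 2) / g (k + 1) ≤ g (k + 3) / g (k + 2)) (k : ℕ) :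
    (Real.log (g (k + 2)) - Real.log (g (k + 2 + 1))) ≤ (Real.log (g (k + 1)) - Real.log (g (k + 1 + 1))) := by
  have h1 := hpos (k + 1)
  have h2 := hpos (k + 2)
  have h3 := hpos (k + 3)
  have key := Real.log_le_log (div_pos h2 h1) (hconv k)
  rw [Real.log_div h2.ne' h1.ne', Real.log_div h3.ne' h2.ne'] at key
  rw [show k + 2 + 1 = k + 3 from rfl, show k + 1 + 1 = k + 2 from rfl]
  linarith

/-- Auxiliary induction for `dec_anti`: `d_{i+t} ≤ d_i` for `i ≥ 1`. -/
theorem dec_anti_aux (hpos : ∀ n, 0 < g n)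
    (hconv : ∀ k, g (k + 2) / g (k + 1) ≤ g (k + 3) / g (k + 2)) {i : ℕ} (hi : 1 ≤ i) :
    ∀ t : ℕ, (Real.log (g (i + t)) - Real.log (g (i + t + 1))) ≤ (Real.log (g i) - Real.log (g (i + 1)))
  | 0 => by simp
  | t + 1 => by
      have hstep : (Real.log (g (i + t + 1)) - Real.log (g (i + t + 1 + 1))) ≤ (Real.log (g (i + t)) - Real.log (g (i + t + 1))) := by
        obtain ⟨i', rfl⟩ : ∃ i', i = i' + 1 := ⟨i - 1, by omega⟩
        have h := dec_succ_le hpos hconv (i' + t)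
        rwa [show i' + 1 + t + 1 = i' + t + 2 by ring, show i' + 1 + t = i' + t + 1 by ring]
      rw [← add_assoc]
      exact hstep.trans (dec_anti_aux hpos hconv hi t)

/-- Antitonicity of the decrements on `[1, ∞)`. -/
theorem dec_anti (hpos : ∀ n, 0 < g n)
    (hconv : ∀ k, g (k + 2) / g (k + 1) ≤ g (k + 3) / g (k + 2)) {i j : ℕ} (hi : 1 ≤ i) (hij : i ≤ j) :
    (Real.log (g j) - Real.log (g (j + 1))) ≤ (Real.log (g i) - Real.log (g (i + 1))) := by
  obtain ⟨t, rfl⟩ := Nat.exists_eq_add_of_le hij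
  exact dec_anti_aux hpos hconv hi t

/-- Telescoping of the decrements. -/
theorem sum_dec (g : ℕ → ℝ) (a : ℕ) :
    ∀ t : ℕ, ∑ i ∈ Finset.range t, (Real.log (g (a + i)) - Real.log (g (a + i + 1))) = Real.log (g a) - Real.log (g (a + t))
  | 0 => by simp
  | t + 1 => by
      rw [Finset.sum_range_succ, sum_dec g a t]
      rw [← add_assoc]; ring

/-- Telescoping of `log`. -/
theorem sum_log_succ_sub_log (a : ℕ) :
    ∀ t : ℕ, ∑ s ∈ Finset.range t, (Real.log (((a + s : ℕ) : ℝ) + 1) - Real.log ((a + s : ℕ) : ℝ)) =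
      Real.log ((a + t : ℕ) : ℝ) - Real.log (a : ℝ)
  | 0 => by simp
  | t + 1 => by
      rw [Finset.sum_range_succ, sum_log_succ_sub_log a t]
      push_cast
      ring

/-- The dilation law at `k` in logarithmic form. -/
theorem log_dilation (hpos : ∀ n, 0 < g n) {Δ : ℝ} {k : ℕ} (hk : 1 ≤ k)
    (h : Tendsto (fun n : ℕ => g (k * n) * (k : ℝ) ^ (2 * Δ) / g n) atTop (𝓝 1)) :
    Tendsto (fun n : ℕ => Real.log (g n) - Real.log (g (k * n))) atTop (𝓝 (2 * Δ * Real.log k)) := by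
  have hk0 : (0 : ℝ) < k := by exact_mod_cast hk
  have hlog := (Real.continuousAt_log one_ne_zero).tendsto.comp h
  rw [Real.log_one] at hlog
  have hlog' : Tendsto (fun n : ℕ => Real.log (g (k * n)) + 2 * Δ * Real.log k - Real.log (g n)) atTop (𝓝 0) := by
    refine hlog.congr fun n => ?_
    simp only [Function.comp_apply]
    rw [Real.log_div (mul_pos (hpos _) (Real.rpow_pos_of_pos hk0 _)).ne' (hpos n).ne',
      Real.log_mul (hpos _).ne' (Real.rpow_pos_of_pos hk0 _).ne', Real.log_rpow hk0]
  have h2 := (tendsto_const_nhds (x := 2 * Δ * Real.log k)).sub hlog'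
  rw [sub_zero] at h2
  exact h2.congr fun n => by ring

/-- The window sum `W_k(n) := ∑_{i<n} d_{kn+i}` telescopes: `W_k(n) = log g(kn) − log g((k+1)n)`. -/
theorem win_eq (g : ℕ → ℝ) (k n : ℕ) : (∑ i ∈ Finset.range n, (Real.log (g (k * n + i)) - Real.log (g (k * n + i + 1)))) =
    Real.log (g (k * n)) - Real.log (g ((k + 1) * n)) := by
  rw [sum_dec]; congr 3; ring

/-- The window sums converge: `W_k(n) → 2Δ (log(k+1) − log k)` (dilation laws at `k` and `k+1`). -/
theorem win_tendsto (hpos : ∀ n, 0 < g n) {Δ : ℝ}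
    (hdil : ∀ k : ℕ, 1 ≤ k → Tendsto (fun n : ℕ => g (k * n) * (k : ℝ) ^ (2 * Δ) / g n) atTop (𝓝 1))
    {k : ℕ} (hk : 1 ≤ k) :
    Tendsto (fun n : ℕ => (∑ i ∈ Finset.range n, (Real.log (g (k * n + i)) - Real.log (g (k * n + i + 1)))))
      atTop (𝓝 (2 * Δ * (Real.log ((k : ℝ) + 1) - Real.log k))) := by
  have h1 := log_dilation hpos hk (hdil k hk)
  have h2 := log_dilation hpos (show 1 ≤ k + 1 by omega) (hdil (k + 1) (by omega))
  have key := h2.sub h1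
  have e1 : (fun n : ℕ => (∑ i ∈ Finset.range n, (Real.log (g (k * n + i)) - Real.log (g (k * n + i + 1))))) = fun n : ℕ =>
      (Real.log (g n) - Real.log (g ((k + 1) * n))) - (Real.log (g n) - Real.log (g (k * n))) := by
    funext n; rw [win_eq]; ring
  have e2 : 2 * Δ * (Real.log ((k : ℝ) + 1) - Real.log k) =
      2 * Δ * Real.log (((k + 1 : ℕ)) : ℝ) - 2 * Δ * Real.log k := by
    push_cast; ring
  rw [e1, e2]; exact key

/-- The sandwich `n·d_{(k+1)n} ≤ W_k(n) ≤ n·d_{kn}` from antitonicity of the decrements. -/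
theorem win_bounds (hpos : ∀ n, 0 < g n)
    (hconv : ∀ k, g (k + 2) / g (k + 1) ≤ g (k + 3) / g (k + 2)) {k n : ℕ} (hk : 1 ≤ k) (hn : 1 ≤ n) :
    (n : ℝ) * (Real.log (g ((k + 1) * n)) - Real.log (g ((k + 1) * n + 1))) ≤
        (∑ i ∈ Finset.range n, (Real.log (g (k * n + i)) - Real.log (g (k * n + i + 1)))) ∧
      (∑ i ∈ Finset.range n, (Real.log (g (k * n + i)) - Real.log (g (k * n + i + 1)))) ≤
        (n : ℝ) * (Real.log (g (k * n)) - Real.log (g (k * n + 1))) := by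
  have hkn : 1 ≤ k * n := by simpa using Nat.mul_le_mul hk hn
  have hsucc : (k + 1) * n = k * n + n := by ring
  constructor
  · have hle : ∀ i ∈ Finset.range n, (Real.log (g ((k + 1) * n)) - Real.log (g ((k + 1) * n + 1))) ≤
        (Real.log (g (k * n + i)) - Real.log (g (k * n + i + 1))) := by
      intro i hi
      have hi' := Finset.mem_range.1 hi
      refine dec_anti hpos hconv (by omega) ?_
      rw [hsucc]
      omega
    have h := Finset.card_nsmul_le_sum (Finset.range n) (fun i => (Real.log (g (k * n + i)) - Real.log (g (k * n + i + 1)))) _ hle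
    simpa [Finset.card_range, nsmul_eq_mul] using h
  · have hle : ∀ i ∈ Finset.range n, (Real.log (g (k * n + i)) - Real.log (g (k * n + i + 1))) ≤
        (Real.log (g (k * n)) - Real.log (g (k * n + 1))) := by
      intro i _
      exact dec_anti hpos hconv hkn (Nat.le_add_right _ _)
    have h := Finset.sum_le_card_nsmul (Finset.range n) (fun i => (Real.log (g (k * n + i)) - Real.log (g (k * n + i + 1)))) _ hle
    simpa [Finset.card_range, nsmul_eq_mul] using h

/-- `k (log(k+1) − log k) → 1`. -/
theorem tendsto_mul_log_succ_sub_log :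
    Tendsto (fun k : ℕ => (k : ℝ) * (Real.log ((k : ℝ) + 1) - Real.log k)) atTop (𝓝 1) := by
  have h := (Real.tendsto_mul_log_one_add_div_atTop 1).comp tendsto_natCast_atTop_atTop
  refine h.congr' ?_
  filter_upwards [eventually_ge_atTop 1] with k hk
  have hk0 : (0 : ℝ) < k := by exact_mod_cast hk
  simp only [Function.comp_apply]
  rw [← Real.log_div (by positivity : (k : ℝ) + 1 ≠ 0) hk0.ne', add_div, div_self hk0.ne']

/-- `log(k+1) − log k → 0`. -/
theorem tendsto_log_succ_sub_log :
    Tendsto (fun k : ℕ => Real.log ((k : ℝ) + 1) - Real.log k) atTop (𝓝 0) := by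
  have h := tendsto_mul_log_succ_sub_log.mul tendsto_one_div_atTop_nhds_zero_nat
  rw [mul_zero] at h
  refine h.congr' ?_
  filter_upwards [eventually_ge_atTop 1] with k hk
  have hk0 : (0 : ℝ) < k := by exact_mod_cast hk
  field_simp

/-- `(k+1) (log(k+1) − log k) → 1`. -/
theorem tendsto_succ_mul_log :
    Tendsto (fun k : ℕ => ((k : ℝ) + 1) * (Real.log ((k : ℝ) + 1) - Real.log k)) atTop (𝓝 1) := by
  have h := tendsto_mul_log_succ_sub_log.add tendsto_log_succ_sub_log
  rw [add_zero] at h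
  exact h.congr fun k => by ring

/-- **Claim A.** `N d_N → 2Δ`. -/
theorem tendsto_mul_dec (hpos : ∀ n, 0 < g n) (hanti : ∀ n, g (n + 1) ≤ g n)
    (hconv : ∀ k, g (k + 2) / g (k + 1) ≤ g (k + 3) / g (k + 2)) {Δ : ℝ}
    (hdil : ∀ k : ℕ, 1 ≤ k → Tendsto (fun n : ℕ => g (k * n) * (k : ℝ) ^ (2 * Δ) / g n) atTop (𝓝 1)) :
    Tendsto (fun N : ℕ => (N : ℝ) * (Real.log (g N) - Real.log (g (N + 1)))) atTop (𝓝 (2 * Δ)) := by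
  rw [tendsto_order]
  constructor
  · -- lower bound: `a < 2Δ` is eventually exceeded
    intro a ha
    have hlim : Tendsto (fun k : ℕ => 2 * Δ * ((k : ℝ) * (Real.log ((k : ℝ) + 1) - Real.log k))) atTop
        (𝓝 (2 * Δ)) := by
      simpa using tendsto_mul_log_succ_sub_log.const_mul (2 * Δ)
    obtain ⟨k, hk, hk1⟩ := ((hlim.eventually (lt_mem_nhds ha)).and (eventually_ge_atTop 1)).exists
    have hwin := win_tendsto hpos hdil hk1
    have hn' : Tendsto (fun N : ℕ => N / k + 1) atTop atTop :=
      tendsto_atTop_mono (fun N => Nat.le_succ _) (Nat.tendsto_div_const_atTop (by omega))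
    have hF : Tendsto (fun N : ℕ => ((k : ℝ) - (k : ℝ) / (((N / k + 1 : ℕ)) : ℝ)) * (∑ i ∈ Finset.range (N / k + 1),
        (Real.log (g (k * (N / k + 1) + i)) - Real.log (g (k * (N / k + 1) + i + 1))))) atTop
        (𝓝 (((k : ℝ) - 0) * (2 * Δ * (Real.log ((k : ℝ) + 1) - Real.log k)))) := by
      refine Tendsto.mul ?_ (hwin.comp hn')
      refine tendsto_const_nhds.sub ?_
      exact tendsto_const_nhds.div_atTop (tendsto_natCast_atTop_atTop.comp hn')
    rw [sub_zero] at hF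
    have ha' : a < (k : ℝ) * (2 * Δ * (Real.log ((k : ℝ) + 1) - Real.log k)) := by
      have e : (k : ℝ) * (2 * Δ * (Real.log ((k : ℝ) + 1) - Real.log k)) =
          2 * Δ * ((k : ℝ) * (Real.log ((k : ℝ) + 1) - Real.log k)) := by ring
      rw [e]; exact hk
    have hev := hF.eventually (lt_mem_nhds ha')
    filter_upwards [hev, eventually_ge_atTop 1] with N hN hN1
    refine hN.trans_le ?_
    set n' : ℕ := N / k + 1 with hn'def
    have hn'1 : 1 ≤ n' := Nat.le_add_left 1 (N / k)
    have hkn' : N ≤ k * n' := (Nat.lt_mul_div_succ N (by omega)).le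
    have hkn'2 : k * n' ≤ N + k := by
      have h1 := Nat.div_mul_le_self N k
      have h2 : k * n' = N / k * k + k := by rw [hn'def]; ring
      rw [h2]
      exact Nat.add_le_add_right h1 k
    obtain ⟨hlow, hup⟩ := win_bounds hpos hconv hk1 hn'1
    have hdec : (Real.log (g (k * n')) - Real.log (g (k * n' + 1))) ≤ (Real.log (g N) - Real.log (g (N + 1))) :=
      dec_anti hpos hconv hN1 hkn'
    have hwin_nonneg : 0 ≤ (∑ i ∈ Finset.range n', (Real.log (g (k * n' + i)) - Real.log (g (k * n' + i + 1)))) :=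
      le_trans (mul_nonneg (by positivity) (dec_nonneg hpos hanti _)) hlow
    have hn'pos : (0 : ℝ) < n' := by exact_mod_cast hn'1
    have hNn : (0 : ℝ) ≤ N := by positivity
    calc ((k : ℝ) - k / n') * (∑ i ∈ Finset.range n', (Real.log (g (k * n' + i)) - Real.log (g (k * n' + i + 1))))
        = ((k : ℝ) * n' - k) / n' * (∑ i ∈ Finset.range n', (Real.log (g (k * n' + i)) - Real.log (g (k * n' + i + 1)))) := by
          field_simp
      _ ≤ (N : ℝ) / n' * (∑ i ∈ Finset.range n', (Real.log (g (k * n' + i)) - Real.log (g (k * n' + i + 1)))) := by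
          apply mul_le_mul_of_nonneg_right _ hwin_nonneg
          apply div_le_div_of_nonneg_right _ hn'pos.le
          have h : ((k * n' : ℕ) : ℝ) ≤ (N : ℝ) + k := by exact_mod_cast hkn'2
          push_cast at h
          linarith
      _ = (N : ℝ) * ((∑ i ∈ Finset.range n', (Real.log (g (k * n' + i)) - Real.log (g (k * n' + i + 1)))) / n') := by ring
      _ ≤ (N : ℝ) * (Real.log (g (k * n')) - Real.log (g (k * n' + 1))) := by
          apply mul_le_mul_of_nonneg_left _ hNn
          rw [div_le_iff₀ hn'pos]
          linarith [hup]
      _ ≤ (N : ℝ) * (Real.log (g N) - Real.log (g (N + 1))) := mul_le_mul_of_nonneg_left hdec hNn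
  · -- upper bound: `a > 2Δ` eventually dominates
    intro a ha
    have hlim : Tendsto (fun k : ℕ => 2 * Δ * (((k : ℝ) + 1) * (Real.log ((k : ℝ) + 1) - Real.log k))) atTop
        (𝓝 (2 * Δ)) := by
      simpa using tendsto_succ_mul_log.const_mul (2 * Δ)
    obtain ⟨k, hk, hk1⟩ := ((hlim.eventually (gt_mem_nhds ha)).and (eventually_ge_atTop 1)).exists
    have hwin := win_tendsto hpos hdil hk1
    have hn : Tendsto (fun N : ℕ => N / (k + 1)) atTop atTop := Nat.tendsto_div_const_atTop (by omega)
    have hF : Tendsto (fun N : ℕ => (((k : ℝ) + 1) + ((k : ℝ) + 1) / (((N / (k + 1) : ℕ)) : ℝ)) * (∑ i ∈ Finset.range (N / (k + 1)),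
        (Real.log (g (k * (N / (k + 1)) + i)) - Real.log (g (k * (N / (k + 1)) + i + 1)))))
        atTop (𝓝 ((((k : ℝ) + 1) + 0) * (2 * Δ * (Real.log ((k : ℝ) + 1) - Real.log k)))) := by
      refine Tendsto.mul ?_ (hwin.comp hn)
      refine tendsto_const_nhds.add ?_
      exact tendsto_const_nhds.div_atTop (tendsto_natCast_atTop_atTop.comp hn)
    rw [add_zero] at hF
    have ha' : ((k : ℝ) + 1) * (2 * Δ * (Real.log ((k : ℝ) + 1) - Real.log k)) < a := by
      have e : ((k : ℝ) + 1) * (2 * Δ * (Real.log ((k : ℝ) + 1) - Real.log k)) =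
          2 * Δ * (((k : ℝ) + 1) * (Real.log ((k : ℝ) + 1) - Real.log k)) := by ring
      rw [e]; exact hk
    have hev := hF.eventually (gt_mem_nhds ha')
    filter_upwards [hev, hn.eventually (eventually_ge_atTop 1)] with N hN hn1
    refine lt_of_le_of_lt ?_ hN
    set n : ℕ := N / (k + 1) with hndef
    have hM : (k + 1) * n ≤ N := by rw [mul_comm]; exact Nat.div_mul_le_self N (k + 1)
    have hM2 : N < (k + 1) * n + (k + 1) := by
      have h := Nat.lt_mul_div_succ N (show 0 < k + 1 by omega)
      rw [Nat.mul_add, mul_one] at h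
      exact h
    have hMpos : 1 ≤ (k + 1) * n := le_trans hn1 (Nat.le_mul_of_pos_left _ (by omega))
    obtain ⟨hlow, hup⟩ := win_bounds hpos hconv hk1 hn1
    have hdec : (Real.log (g N) - Real.log (g (N + 1))) ≤ (Real.log (g ((k + 1) * n)) - Real.log (g ((k + 1) * n + 1))) :=
      dec_anti hpos hconv hMpos hM
    have hnpos : (0 : ℝ) < n := by exact_mod_cast hn1
    have hdnn : 0 ≤ (Real.log (g ((k + 1) * n)) - Real.log (g ((k + 1) * n + 1))) := dec_nonneg hpos hanti _
    have hNn : (0 : ℝ) ≤ N := by positivity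
    calc (N : ℝ) * (Real.log (g N) - Real.log (g (N + 1)))
        ≤ (N : ℝ) * (Real.log (g ((k + 1) * n)) - Real.log (g ((k + 1) * n + 1))) := mul_le_mul_of_nonneg_left hdec hNn
      _ ≤ (((k : ℝ) + 1) * n + ((k : ℝ) + 1)) * (Real.log (g ((k + 1) * n)) - Real.log (g ((k + 1) * n + 1))) := by
          apply mul_le_mul_of_nonneg_right _ hdnn
          have h : (N : ℝ) < (((k + 1) * n + (k + 1) : ℕ) : ℝ) := by exact_mod_cast hM2
          push_cast at h
          linarith
      _ = (((k : ℝ) + 1) + ((k : ℝ) + 1) / n) * ((n : ℝ) * (Real.log (g ((k + 1) * n)) - Real.log (g ((k + 1) * n + 1)))) := by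
          field_simp
      _ ≤ (((k : ℝ) + 1) + ((k : ℝ) + 1) / n) * (∑ i ∈ Finset.range n, (Real.log (g (k * n + i)) - Real.log (g (k * n + i + 1)))) :=
          mul_le_mul_of_nonneg_left hlow (by positivity)

/-- **Claim B = transfer U.** Integer dilation law ⇒ uniform dilation law on windows `[b, 2b]`. -/
theorem uniform_of_integer (hpos : ∀ n, 0 < g n) (hanti : ∀ n, g (n + 1) ≤ g n)
    (hconv : ∀ k, g (k + 2) / g (k + 1) ≤ g (k + 3) / g (k + 2)) {Δ : ℝ}
    (hdil : ∀ k : ℕ, 1 ≤ k → Tendsto (fun n : ℕ => g (k * n) * (k : ℝ) ^ (2 * Δ) / g n) atTop (𝓝 1)) :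
    ∀ b m : ℕ → ℕ, Tendsto b atTop atTop → (∀ᶠ i in atTop, b i ≤ m i ∧ m i ≤ 2 * b i) →
      Tendsto (fun i : ℕ => g (m i) * ((m i : ℝ) / (b i : ℝ)) ^ (2 * Δ) / g (b i)) atTop (𝓝 1) := by
  intro b m hb hbm
  have hA := tendsto_mul_dec hpos hanti hconv hdil
  -- `j e_j → 0` with `e_j := d_j − 2Δ (log(j+1) − log j)`
  have he : Tendsto (fun j : ℕ => (j : ℝ) * ((Real.log (g j) - Real.log (g (j + 1))) - 2 * Δ * (Real.log ((j : ℝ) + 1) - Real.log j))) atTop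
      (𝓝 0) := by
    have h := hA.sub (tendsto_mul_log_succ_sub_log.const_mul (2 * Δ))
    rw [mul_one, sub_self] at h
    exact h.congr fun j => by ring
  -- the defect sums tend to zero
  have hD : Tendsto (fun i : ℕ => ∑ t ∈ Finset.range (m i - b i),
      ((Real.log (g (b i + t)) - Real.log (g (b i + t + 1))) - 2 * Δ * (Real.log (((b i + t : ℕ) : ℝ) + 1) - Real.log ((b i + t : ℕ) : ℝ))))
      atTop (𝓝 0) := by
    rw [Metric.tendsto_nhds]
    intro ε hε
    have hev := Metric.tendsto_nhds.1 he (ε / 2) (by positivity)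
    obtain ⟨J, hJ⟩ := eventually_atTop.1 hev
    filter_upwards [hb.eventually (eventually_ge_atTop (max J 1)), hbm] with i hi hibm
    rw [Real.dist_eq, sub_zero]
    have hb1 : 1 ≤ b i := le_trans (le_max_right _ _) hi
    have hbJ : J ≤ b i := le_trans (le_max_left _ _) hi
    have hbpos : (0 : ℝ) < b i := by exact_mod_cast hb1
    calc |∑ t ∈ Finset.range (m i - b i),
            ((Real.log (g (b i + t)) - Real.log (g (b i + t + 1))) - 2 * Δ * (Real.log (((b i + t : ℕ) : ℝ) + 1) - Real.log ((b i + t : ℕ) : ℝ)))|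
        ≤ ∑ t ∈ Finset.range (m i - b i),
            |(Real.log (g (b i + t)) - Real.log (g (b i + t + 1))) - 2 * Δ * (Real.log (((b i + t : ℕ) : ℝ) + 1) - Real.log ((b i + t : ℕ) : ℝ))| :=
          Finset.abs_sum_le_sum_abs _ _
      _ ≤ ∑ t ∈ Finset.range (m i - b i), (ε / 2) / (b i : ℝ) := by
          refine Finset.sum_le_sum fun t _ => ?_
          have hj : J ≤ b i + t := by omega
          have hjpos : (0 : ℝ) < ((b i + t : ℕ) : ℝ) := by positivity
          have h := hJ (b i + t) hj
          rw [Real.dist_eq, sub_zero, abs_mul, abs_of_pos hjpos] at h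
          have h1 : |(Real.log (g (b i + t)) - Real.log (g (b i + t + 1))) - 2 * Δ * (Real.log (((b i + t : ℕ) : ℝ) + 1) - Real.log ((b i + t : ℕ) : ℝ))|
              < (ε / 2) / ((b i + t : ℕ) : ℝ) := by
            rw [lt_div_iff₀ hjpos]
            linarith
          refine h1.le.trans ?_
          apply div_le_div_of_nonneg_left (by positivity) hbpos
          exact_mod_cast Nat.le_add_right (b i) t
      _ = ((m i - b i : ℕ) : ℝ) * ((ε / 2) / b i) := by
          rw [Finset.sum_const, Finset.card_range, nsmul_eq_mul]
      _ ≤ (b i : ℝ) * ((ε / 2) / b i) := by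
          apply mul_le_mul_of_nonneg_right _ (by positivity)
          have h : m i - b i ≤ b i := by omega
          exact_mod_cast h
      _ = ε / 2 := by field_simp
      _ < ε := by linarith
  -- the logarithm of the target ratio is minus the defect sum (eventually)
  have hlogR : ∀ᶠ i in atTop, Real.log (g (m i) * ((m i : ℝ) / (b i : ℝ)) ^ (2 * Δ) / g (b i)) =
      -(∑ t ∈ Finset.range (m i - b i),
        ((Real.log (g (b i + t)) - Real.log (g (b i + t + 1))) - 2 * Δ * (Real.log (((b i + t : ℕ) : ℝ) + 1) - Real.log ((b i + t : ℕ) : ℝ)))) := by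
    filter_upwards [hb.eventually (eventually_ge_atTop 1), hbm] with i hb1 hibm
    have hbpos : (0 : ℝ) < b i := by exact_mod_cast hb1
    have hmpos : (0 : ℝ) < m i := by exact_mod_cast (le_trans hb1 hibm.1)
    have hbm' : b i + (m i - b i) = m i := by omega
    rw [Finset.sum_sub_distrib, sum_dec g (b i) (m i - b i), ← Finset.mul_sum,
      sum_log_succ_sub_log (b i) (m i - b i), hbm']
    rw [Real.log_div (mul_pos (hpos _) (Real.rpow_pos_of_pos (div_pos hmpos hbpos) _)).ne' (hpos _).ne',
      Real.log_mul (hpos _).ne' (Real.rpow_pos_of_pos (div_pos hmpos hbpos) _).ne',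
      Real.log_rpow (div_pos hmpos hbpos), Real.log_div hmpos.ne' hbpos.ne']
    ring
  have hlog0 : Tendsto (fun i : ℕ => Real.log (g (m i) * ((m i : ℝ) / (b i : ℝ)) ^ (2 * Δ) / g (b i))) atTop
      (𝓝 0) := by
    have h := hD.neg
    rw [neg_zero] at h
    exact h.congr' (hlogR.mono fun i hi => hi.symm)
  have hexp := (Real.continuous_exp.tendsto 0).comp hlog0
  rw [Real.exp_zero] at hexp
  refine hexp.congr' ?_
  filter_upwards [hb.eventually (eventually_ge_atTop 1), hbm] with i hb1 hibm
  simp only [Function.comp_apply]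
  have hbpos : (0 : ℝ) < b i := by exact_mod_cast hb1
  have hmpos : (0 : ℝ) < m i := by exact_mod_cast (le_trans hb1 hibm.1)
  exact Real.exp_log (div_pos (mul_pos (hpos _) (Real.rpow_pos_of_pos (div_pos hmpos hbpos) _)) (hpos _))

end RV

/-- **U (uniform dilation transfer), the registered stub `stub_uniformDilationTransfer` of line
`tower_profile_rigidity`, verbatim.** For every exponent `Δ`, the integer dilation law
`⟨σ₀σ_{kn e₀}⟩_{β_c}·k^{2Δ}/⟨σ₀σ_{n e₀}⟩_{β_c} → 1` (every `k ≥ 1`) of the critical Ising two-point function on `ℤ³`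
implies the UNIFORM dilation law `⟨σ₀σ_{m e₀}⟩·(m/b)^{2Δ}/⟨σ₀σ_{b e₀}⟩ → 1` whenever `b → ∞` and `b ≤ m ≤ 2b`
eventually: `RV.uniform_of_integer` fed with positivity (`criticalTwoPoint_axis_pos`), MMS antitonicity
(`criticalTwoPoint_axis_antitone`) and log-convexity (`criticalTwoPoint_axis_ratio_mono`). [folklore] -/
theorem stub_uniformDilationTransfer :
    ∀ Δ : ℝ, (∀ k : ℕ, 1 ≤ k → Filter.Tendsto (fun n : ℕ => Literature.Probability.LatticeModels.criticalTwoPoint 3 (Pi.single 0 ((k * n : ℕ) : ℤ)) * (k : ℝ) ^ (2 * Δ) / Literature.Probability.LatticeModels.criticalTwoPoint 3 (Pi.single 0 ((n : ℕ) : ℤ))) Filter.atTop (nhds 1)) → ∀ b m : ℕ → ℕ, Filter.Tendsto b Filter.atTop Filter.atTop → (∀ᶠ i in Filter.atTop, b i ≤ m i ∧ m i ≤ 2 * b i) → Filter.Tendsto (fun i : ℕ => Literature.Probability.LatticeModels.criticalTwoPoint 3 (Pi.single 0 ((m i : ℕ) : ℤ)) * ((m i : ℝ) / (b i : ℝ))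 ^ (2 * Δ) / Literature.Probability.LatticeModels.criticalTwoPoint 3 (Pi.single 0 ((b i : ℕ) : ℤ))) Filter.atTop (nhds 1) :=
  fun _Δ hdil =>
    RV.uniform_of_integer (g := fun n : ℕ => criticalTwoPoint 3 (Pi.single 0 ((n : ℕ) : ℤ)))
      (fun n => criticalTwoPoint_axis_pos n) (fun n => criticalTwoPoint_axis_antitone (Nat.le_succ n))
      (fun k => criticalTwoPoint_axis_ratio_mono 0 (Nat.le_succ k)) hdil

end Summit.CriticalPhenomena.Ising3DConformalLimit.Cruxes.IsingEuclidUpgradeR2RotInvPowerLaw.TowerProfileRigidity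

end
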